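import Literature.NumberTheory.ConnesMoscovici2022.UVProlateSpectrum
import Literature.Analysis.ODE.HalfLineShooting
import HarnessLib

/-!
# Connes–Moscovici 2022, Lemma 4.2 PROVED: zeros of `u₁ + zu₂` on `(λ, ∞)` and the solutions
# `w_z` of the Riccati equation (4.2)

RH-FREE corpus literature (classical Sturm–Liouville / Riccati facts for the operator
`L = ∂(p∂) + V`, `p = x² − λ²`, `V = 4π²λ²x²`, on the half-line `(λ, ∞)`; UV sequel row, no leaf
role; nothing here bears on the truth of RH); cell rh-crit, corpus O2 row (typer seat t8),
discharge by seat t16.  WHAT THIS IS NOT: any claim about RH, nor about the eigenvalue count of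
Thm 5.1 — nothing here bears on the truth of RH.  Theorems only (no `def`, no named fact, no
instance): `CM22_lemma_4_2_holds : CM22_lemma_4_2` (net debt −1) and the cited intermediate
results below; plumbing is `private`.

Source: A. Connes, H. Moscovici, *The UV prolate spectrum matches the zeros of zeta*, PNAS 119
(2022) [bib: `ConnesMoscovici2022`], Lemma 4.2 (= arXiv:2112.05500 Lemma 5.2, held text chunk
p0010:L41–L47, proof L49–L86).

## The printed statement and its proof, as formalised

For two real `C²` solutions `u₁, u₂` of `Lu = 0` on `(λ, ∞)` with non-vanishing Wronskian
(hypotheses of the typed fact `CM22_lemma_4_2`, seat t8):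

* `realODE_of_opL_eq_zero` — the typed `opL`-equation is the real ODE `p u″ + 2x u′ + V u = 0`;
* `pOut_mul_wronskian_const`, `wronskian_ne_zero` — **Abel's identity** `p·(u₁u₂′ − u₂u₁′) = const`,
  so the Wronskian never vanishes; `add_mul_ne_zero_of_im_ne_zero` — **(i), `z ∉ ℝ`**: a zero of
  `u₁ + zu₂` forces (real and imaginary parts) `u₁ = u₂ = 0` there, contradicting the Wronskian;
* `exists_zero_Icc_of_realODE`, `infinite_zeros_of_realODE`, `infinite_zeros_add_mul` — **(i),
  `z ∈ ℝ`**: in Liouville normal form `v = √p·u` the equation reads `v″ = q̃v` with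
  `q̃ = −V/p + (p − x²)/p² ≤ −(2πλ)²`, so Sturm's comparison theorem — the TREE's
  `Literature.Analysis.ODE.exists_zero_of_le_neg_sq` (Hartman XI Thm 6.2, window constant `10`)
  — puts a zero of every real solution in every window `[α, α + 1/λ]`, `α > λ`
  (`(2πλ)²·λ⁻² = 4π² > 10`); hence infinitely many zeros;
* `isRiccatiSol_logDeriv`, `wz_eq_logDeriv`, `isRiccatiSol_wz` — **(ii)**: for a zero-free
  solution, `w = p^{1/4}∂(p^{1/4}u)/u = x/(2√p) + √p·u′/u` and
  `∇w + w² = ½ − x²/(4p) − V = −V + (p″/4 − p′²/(16p))`, the Riccati equation (4.2)/(4.1);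
* `eq_lin_of_complexSol` (uniqueness for the linear equation — the TREE's
  `Literature.Analysis.ODE.eqOn_of_solution_Ioo`, Hartman IV Lemma 1.1 — gives `U = c₁u₁ + c₂u₂`
  for every complex solution) and `existsUnique_z_of_isRiccatiSol` — **(iii)**: for a Riccati
  solution `w`, `u = exp ∫(w − x/(2√p))/√p` is a zero-free solution of `Lu = 0` (the computation
  of (ii) read backwards), `u = c₁(u₁ + zu₂)` with `c₁ ≠ 0` and `z ∉ ℝ` by the oscillation of real
  solutions, `w = w_z`, and `w_z(x₀) = w_{z′}(x₀)` gives `(z′ − z)·W(x₀) = 0`, i.e. uniqueness.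

(The printed "(iii) `z ↦ w_z` is a homeomorphism" is typed as the bijection only — continuity was
not typed by seat t8 and is not addressed here.)
-/

noncomputable section

open Set Filter Complex
open scoped Real Topology

namespace Literature.NumberTheory.ConnesMoscovici2022

section Riccati

variable {lam : ℝ}

/-! ### Plumbing on `(λ, ∞)`: `p = x² − λ² > 0`, derivatives of `p`, `√p` -/

/-- `p(x) = x² − λ² > 0` for `x > λ > 0`. [folklore] -/
private theorem pOut_pos' (hlam : 0 < lam) {x : ℝ} (hx : x ∈ Ioi lam) : 0 < pOut lam x := by
  have : lam < x := hx
  have hx0 : 0 < x := hlam.trans this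
  unfold pOut; nlinarith

/-- `p(x) = x² − λ²`, unfolded. [folklore] -/
private theorem pOut_eq (lam x : ℝ) : pOut lam x = x ^ 2 - lam ^ 2 := rfl

/-- `p′(x) = 2x`. [folklore] -/
private theorem hasDerivAt_pOut' (lam x : ℝ) : HasDerivAt (pOut lam) (2 * x) x := by
  unfold pOut
  simpa using ((hasDerivAt_pow 2 x).sub_const (lam ^ 2))

/-- `(√p)′ = x/√p` on `(λ, ∞)`. [folklore] -/
private theorem hasDerivAt_sqrt_pOut' (hlam : 0 < lam) {x : ℝ} (hx : x ∈ Ioi lam) :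
    HasDerivAt (fun y => Real.sqrt (pOut lam y)) (x / Real.sqrt (pOut lam x)) x := by
  have h := (hasDerivAt_pOut' lam x).sqrt (pOut_pos' hlam hx).ne'
  refine h.congr_deriv ?_
  field_simp

/-! ### Real solutions of `Lu = 0`: from the typed (complex, `deriv`-based) form to the real ODE -/

/-- A `C²` function on `(λ, ∞)` has first and second derivatives there (plumbing). [folklore] -/
private theorem hasDerivAt_of_contDiffOn_two {u : ℝ → ℝ} (hu : ContDiffOn ℝ 2 u (Ioi lam))
    {x : ℝ} (hx : x ∈ Ioi lam) :
    HasDerivAt u (deriv u x) x ∧ HasDerivAt (deriv u) (deriv (deriv u) x) x := by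
  have hxo : Ioi lam ∈ 𝓝 x := isOpen_Ioi.mem_nhds hx
  refine ⟨((hu.differentiableOn (by norm_num)).differentiableAt hxo).hasDerivAt, ?_⟩
  have hdf : DifferentiableOn ℝ (deriv u) (Ioi lam) :=
    (hu.deriv_of_isOpen (m := 1) isOpen_Ioi (by norm_num)).differentiableOn (by norm_num)
  exact (hdf.differentiableAt hxo).hasDerivAt

/-- The typed equation `L u = 0` (`opL`, complex-valued, `deriv`-based) for a real `C²` function
`u` on `(λ, ∞)` is the real ODE `p u″ + 2x u′ + V u = 0`. [cite: ConnesMoscovici2022, Lemma 4.1 (= arXiv Lemma 5.1, chunk p0010:L5)] -/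
theorem realODE_of_opL_eq_zero {u : ℝ → ℝ} (hu : ContDiffOn ℝ 2 u (Ioi lam))
    (hL : ∀ x ∈ Ioi lam, opL lam (fun y ↦ (u y : ℂ)) x = 0) {x : ℝ} (hx : x ∈ Ioi lam) :
    pOut lam x * deriv (deriv u) x + 2 * x * deriv u x + vPot lam x * u x = 0 := by
  have hxo : Ioi lam ∈ 𝓝 x := isOpen_Ioi.mem_nhds hx
  have h1 : ∀ y ∈ Ioi lam, HasDerivAt (fun t => (u t : ℂ)) ((deriv u y : ℝ) : ℂ) y :=
    fun y hy => (hasDerivAt_of_contDiffOn_two hu hy).1.ofReal_comp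
  have hde : deriv (fun t => (u t : ℂ)) =ᶠ[𝓝 x] fun t => ((deriv u t : ℝ) : ℂ) :=
    Filter.eventually_of_mem hxo fun y hy => (h1 y hy).deriv
  have h2 : HasDerivAt (fun y => ((pOut lam y : ℝ) : ℂ) * ((deriv u y : ℝ) : ℂ))
      (((2 * x * deriv u x + pOut lam x * deriv (deriv u) x : ℝ) : ℂ)) x := by
    have := ((hasDerivAt_pOut' lam x).ofReal_comp).mul
      ((hasDerivAt_of_contDiffOn_two hu hx).2.ofReal_comp)
    refine this.congr_deriv ?_
    push_cast; ring
  have h3 : HasDerivAt (fun y => ((pOut lam y : ℝ) : ℂ) * deriv (fun t => (u t : ℂ)) y)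
      (((2 * x * deriv u x + pOut lam x * deriv (deriv u) x : ℝ) : ℂ)) x :=
    h2.congr_of_eventuallyEq (by filter_upwards [hde] with y hy; rw [hy])
  have h := hL x hx
  unfold opL at h
  rw [h3.deriv] at h
  have h' := congrArg Complex.re h
  simp only [Complex.add_re, Complex.ofReal_re, Complex.mul_re, Complex.ofReal_im, zero_mul,
    sub_zero, Complex.zero_re] at h'
  linarith

/-! ### Abel's identity and clause (i) for `z ∉ ℝ` -/

/-- **Abel's identity** for `L = ∂(p∂) + V`: for two real `C²` solutions of `Lu = 0` on `(λ, ∞)`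
the quantity `p·(u₁u₂′ − u₂u₁′)` is constant on `(λ, ∞)`. [cite: ConnesMoscovici2022, Lemma 4.2 proof (= arXiv Lemma 5.2, chunk p0010:L49–L60)] -/
theorem pOut_mul_wronskian_const (hlam : 0 < lam) {u₁ u₂ : ℝ → ℝ}
    (hu₁ : ContDiffOn ℝ 2 u₁ (Ioi lam)) (hu₂ : ContDiffOn ℝ 2 u₂ (Ioi lam))
    (hL₁ : ∀ x ∈ Ioi lam, opL lam (fun y ↦ (u₁ y : ℂ)) x = 0)
    (hL₂ : ∀ x ∈ Ioi lam, opL lam (fun y ↦ (u₂ y : ℂ)) x = 0) {x y : ℝ} (hx : x ∈ Ioi lam)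
    (hy : y ∈ Ioi lam) :
    pOut lam x * (u₁ x * deriv u₂ x - u₂ x * deriv u₁ x) =
      pOut lam y * (u₁ y * deriv u₂ y - u₂ y * deriv u₁ y) := by
  have _ := hlam
  set f : ℝ → ℝ := fun t => pOut lam t * (u₁ t * deriv u₂ t - u₂ t * deriv u₁ t) with hf
  have hderiv : ∀ t ∈ Ioi lam, HasDerivAt f 0 t := by
    intro t ht
    obtain ⟨h11, h12⟩ := hasDerivAt_of_contDiffOn_two hu₁ ht
    obtain ⟨h21, h22⟩ := hasDerivAt_of_contDiffOn_two hu₂ ht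
    have hode₁ := realODE_of_opL_eq_zero hu₁ hL₁ ht
    have hode₂ := realODE_of_opL_eq_zero hu₂ hL₂ ht
    have h := (hasDerivAt_pOut' lam t).mul ((h11.mul h22).sub (h21.mul h12))
    refine h.congr_deriv ?_
    simp only [Pi.mul_apply, Pi.sub_apply]
    linear_combination u₁ t * hode₂ - u₂ t * hode₁
  have hdiff : DifferentiableOn ℝ f (Ioi lam) := fun t ht =>
    (hderiv t ht).differentiableAt.differentiableWithinAt
  have hzero : (Ioi lam).EqOn (deriv f) 0 := fun t ht => (hderiv t ht).deriv
  exact isOpen_Ioi.is_const_of_deriv_eq_zero (convex_Ioi lam).isPreconnected hdiff hzero hx hy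

/-- The Wronskian of two real solutions, nonzero at one point of `(λ, ∞)`, is nonzero everywhere
on `(λ, ∞)`. [cite: ConnesMoscovici2022, Lemma 4.2 proof (= arXiv Lemma 5.2, chunk p0010:L49–L60)] -/
theorem wronskian_ne_zero (hlam : 0 < lam) {u₁ u₂ : ℝ → ℝ}
    (hu₁ : ContDiffOn ℝ 2 u₁ (Ioi lam)) (hu₂ : ContDiffOn ℝ 2 u₂ (Ioi lam))
    (hL₁ : ∀ x ∈ Ioi lam, opL lam (fun y ↦ (u₁ y : ℂ)) x = 0)
    (hL₂ : ∀ x ∈ Ioi lam, opL lam (fun y ↦ (u₂ y : ℂ)) x = 0)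
    (hW : ∃ x ∈ Ioi lam, u₁ x * deriv u₂ x - u₂ x * deriv u₁ x ≠ 0) {x : ℝ} (hx : x ∈ Ioi lam) :
    u₁ x * deriv u₂ x - u₂ x * deriv u₁ x ≠ 0 := by
  obtain ⟨x₀, hx₀, hW₀⟩ := hW
  intro h0
  have h := pOut_mul_wronskian_const hlam hu₁ hu₂ hL₁ hL₂ hx hx₀
  rw [h0, mul_zero] at h
  exact hW₀ ((mul_eq_zero.mp h.symm).resolve_left (pOut_pos' hlam hx₀).ne')

/-- **Lemma 4.2 (i), first half**: `u₁ + z u₂` has no zero on `(λ, ∞)` when `z ∉ ℝ` (real and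
imaginary parts of `u₁(x) + z u₂(x) = 0` give `u₁(x) = u₂(x) = 0`, so the Wronskian vanishes at
`x`). [cite: ConnesMoscovici2022, Lemma 4.2 (i) (= arXiv Lemma 5.2 (i), chunk p0010:L41–L47; proof L49–L60)] -/
theorem add_mul_ne_zero_of_im_ne_zero (hlam : 0 < lam) {u₁ u₂ : ℝ → ℝ}
    (hu₁ : ContDiffOn ℝ 2 u₁ (Ioi lam)) (hu₂ : ContDiffOn ℝ 2 u₂ (Ioi lam))
    (hL₁ : ∀ x ∈ Ioi lam, opL lam (fun y ↦ (u₁ y : ℂ)) x = 0)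
    (hL₂ : ∀ x ∈ Ioi lam, opL lam (fun y ↦ (u₂ y : ℂ)) x = 0)
    (hW : ∃ x ∈ Ioi lam, u₁ x * deriv u₂ x - u₂ x * deriv u₁ x ≠ 0) {z : ℂ} (hz : z.im ≠ 0)
    {x : ℝ} (hx : x ∈ Ioi lam) : (u₁ x : ℂ) + z * u₂ x ≠ 0 := by
  intro h
  have him := congrArg Complex.im h
  simp only [Complex.add_im, Complex.ofReal_im, Complex.mul_im, Complex.ofReal_re, zero_add,
    Complex.zero_im, mul_zero] at him
  have hu2 : u₂ x = 0 := by
    rcases mul_eq_zero.mp him with h1 | h1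
    · exact absurd h1 hz
    · exact h1
  have hu1 : u₁ x = 0 := by
    rw [hu2] at h
    simpa using h
  exact wronskian_ne_zero hlam hu₁ hu₂ hL₁ hL₂ hW hx (by rw [hu1, hu2]; ring)

/-! ### Oscillation: every real solution has a zero in every window of length `1/λ` -/

/-- **Liouville normal form and Sturm's window.** If `(u, u′, u″)` solve `p u″ + 2x u′ + V u = 0`
on `(λ, ∞)` (real), then `v = √p·u` solves `v″ = q̃ v` with
`q̃ = −V/p − λ²/p² ≤ −(2πλ)²`, so by Sturm's comparison theorem (the tree's
`Literature.Analysis.ODE.exists_zero_of_le_neg_sq`, Hartman XI Thm 6.2) `u` vanishes somewhere in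
every window `[α, α + 1/λ]`, `α > λ`. [cite: ConnesMoscovici2022, Lemma 4.2 (i) (= arXiv Lemma 5.2 (i), chunk p0010:L41–L47; proof L49–L60)] -/
theorem exists_zero_Icc_of_realODE (hlam : 0 < lam) {u ud udd : ℝ → ℝ}
    (h : ∀ x ∈ Ioi lam, HasDerivAt u (ud x) x ∧ HasDerivAt ud (udd x) x ∧
      pOut lam x * udd x + 2 * x * ud x + vPot lam x * u x = 0)
    {α : ℝ} (hα : lam < α) : ∃ x ∈ Icc α (α + 1 / lam), u x = 0 := by
  -- the normal form
  set s : ℝ → ℝ := fun x => Real.sqrt (pOut lam x) with hs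
  set v : ℝ → ℝ := fun x => s x * u x with hv
  set v' : ℝ → ℝ := fun x => x / s x * u x + s x * ud x with hv'
  set q : ℝ → ℝ := fun x => -(vPot lam x) / pOut lam x + (pOut lam x - x ^ 2) / (pOut lam x) ^ 2 with hq
  have hq_cont : ContinuousOn q (Ioi lam) := by
    have hp : Continuous (pOut lam) := by
      unfold pOut; fun_prop
    have hV : Continuous (vPot lam) := by
      unfold vPot; fun_prop
    refine ContinuousOn.add ?_ ?_
    · exact (hV.neg.continuousOn).div hp.continuousOn fun x hx => (pOut_pos' hlam hx).ne'
    · exact (hp.sub (continuous_id.pow 2)).continuousOn.div (hp.pow 2).continuousOn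
        fun x hx => (pow_pos (pOut_pos' hlam hx) 2).ne'
  have hsol : ∀ t ∈ Ioi lam, HasDerivAt v (v' t) t ∧ HasDerivAt v' (q t * v t) t := by
    intro t ht
    obtain ⟨h1, h2, hode⟩ := h t ht
    have hp0 := pOut_pos' hlam ht
    have hs0 : 0 < s t := Real.sqrt_pos.2 hp0
    have hs2 : s t ^ 2 = pOut lam t := Real.sq_sqrt hp0.le
    have hsd : HasDerivAt s (t / s t) t := hasDerivAt_sqrt_pOut' hlam ht
    refine ⟨?_, ?_⟩
    · exact (hsd.mul h1).congr_deriv (by simp only [hv'])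
    · have hxs : HasDerivAt (fun x => x / s x) ((1 * s t - t * (t / s t)) / s t ^ 2) t :=
        (hasDerivAt_id t).div hsd hs0.ne'
      have hd := (hxs.mul h1).add (hsd.mul h2)
      refine hd.congr_deriv ?_
      have hudd : udd t = -(2 * t * ud t + vPot lam t * u t) / pOut lam t := by
        field_simp
        linarith [hode]
      have hP : pOut lam t = s t ^ 2 := hs2.symm
      simp only [hq, hv, hudd]
      rw [hP]
      field_simp
      ring
  -- Sturm's window with `k = 2πλ` on `[α, α + 1/λ]`
  have hβ : α < α + 1 / lam := by
    have : 0 < 1 / lam := by positivity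
    linarith
  have hqk : ∀ x ∈ Icc α (α + 1 / lam), q x ≤ -(2 * π * lam) ^ 2 := by
    intro x hx
    have hxI : x ∈ Ioi lam := lt_of_lt_of_le hα hx.1
    have hp0 := pOut_pos' hlam hxI
    have hx0 : lam < x := hxI
    simp only [hq]
    have h1 : -(vPot lam x) / pOut lam x ≤ -(2 * π * lam) ^ 2 := by
      unfold vPot
      rw [pOut_eq] at hp0 ⊢
      rw [div_le_iff₀ hp0]
      nlinarith [sq_nonneg (π * lam ^ 2), Real.pi_pos]
    have h2 : (pOut lam x - x ^ 2) / pOut lam x ^ 2 ≤ 0 := by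
      apply div_nonpos_of_nonpos_of_nonneg
      · rw [pOut_eq]; nlinarith
      · positivity
    linarith
  have hk : 10 < (2 * π * lam) ^ 2 * (α + 1 / lam - α) ^ 2 := by
    have : (2 * π * lam) ^ 2 * (α + 1 / lam - α) ^ 2 = 4 * π ^ 2 := by
      field_simp
      ring
    rw [this]
    nlinarith [Real.pi_gt_three]
  obtain ⟨z, hz, hvz⟩ :=
    Literature.Analysis.ODE.exists_zero_of_le_neg_sq hq_cont hsol hα hβ hqk hk
  refine ⟨z, hz, ?_⟩
  have hzI : z ∈ Ioi lam := lt_of_lt_of_le hα hz.1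
  have hs0 : 0 < s z := Real.sqrt_pos.2 (pOut_pos' hlam hzI)
  simp only [hv] at hvz
  exact (mul_eq_zero.mp hvz).resolve_left hs0.ne'

/-- Every real solution of `p u″ + 2x u′ + V u = 0` on `(λ, ∞)` has infinitely many zeros there.
[cite: ConnesMoscovici2022, Lemma 4.2 (i) (= arXiv Lemma 5.2 (i), chunk p0010:L41–L47)] -/
theorem infinite_zeros_of_realODE (hlam : 0 < lam) {u ud udd : ℝ → ℝ}
    (h : ∀ x ∈ Ioi lam, HasDerivAt u (ud x) x ∧ HasDerivAt ud (udd x) x ∧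
      pOut lam x * udd x + 2 * x * ud x + vPot lam x * u x = 0) :
    Set.Infinite {x | x ∈ Ioi lam ∧ u x = 0} := by
  intro hfin
  obtain ⟨M, hM⟩ := hfin.bddAbove
  have hα : lam < max M lam + 1 := by
    have := le_max_right M lam; linarith
  obtain ⟨x, hx, hux⟩ := exists_zero_Icc_of_realODE hlam h hα
  have hxI : x ∈ Ioi lam := lt_of_lt_of_le hα hx.1
  have hle : x ≤ M := hM ⟨hxI, hux⟩
  have := le_max_left M lam
  linarith [hx.1]

/-- **Lemma 4.2 (i), second half**: for real `z`, `u₁ + z u₂` has infinitely many zeros in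
`(λ, ∞)`. [cite: ConnesMoscovici2022, Lemma 4.2 (i) (= arXiv Lemma 5.2 (i), chunk p0010:L41–L47; proof L49–L60)] -/
theorem infinite_zeros_add_mul (hlam : 0 < lam) {u₁ u₂ : ℝ → ℝ}
    (hu₁ : ContDiffOn ℝ 2 u₁ (Ioi lam)) (hu₂ : ContDiffOn ℝ 2 u₂ (Ioi lam))
    (hL₁ : ∀ x ∈ Ioi lam, opL lam (fun y ↦ (u₁ y : ℂ)) x = 0)
    (hL₂ : ∀ x ∈ Ioi lam, opL lam (fun y ↦ (u₂ y : ℂ)) x = 0) (z : ℝ) :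
    Set.Infinite {x | x ∈ Ioi lam ∧ u₁ x + z * u₂ x = 0} := by
  refine infinite_zeros_of_realODE hlam (u := fun x => u₁ x + z * u₂ x)
    (ud := fun x => deriv u₁ x + z * deriv u₂ x)
    (udd := fun x => deriv (deriv u₁) x + z * deriv (deriv u₂) x) fun x hx => ?_
  obtain ⟨h11, h12⟩ := hasDerivAt_of_contDiffOn_two hu₁ hx
  obtain ⟨h21, h22⟩ := hasDerivAt_of_contDiffOn_two hu₂ hx
  have hode₁ := realODE_of_opL_eq_zero hu₁ hL₁ hx
  have hode₂ := realODE_of_opL_eq_zero hu₂ hL₂ hx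
  exact ⟨h11.add (h21.const_mul z), h12.add (h22.const_mul z),
    by linear_combination hode₁ + z * hode₂⟩

/-! ### Clause (ii): `w = x/(2√p) + √p·u′/u` solves the Riccati equation for a zero-free solution -/

/-- `(p^{1/4})′ = ¼ p^{−3/4}·2x` on `(λ, ∞)` (plumbing). [folklore] -/
private theorem hasDerivAt_rpow_quarter (hlam : 0 < lam) {x : ℝ} (hx : x ∈ Ioi lam) :
    HasDerivAt (fun y => (pOut lam y) ^ (1 / 4 : ℝ))
      ((1 / 4 : ℝ) * (pOut lam x) ^ ((1 / 4 : ℝ) - 1) * (2 * x)) x := by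
  have hp := (pOut_pos' hlam hx).ne'
  have h := (hasDerivAt_pOut' lam x).rpow_const (p := (1 / 4 : ℝ)) (Or.inl hp)
  convert h using 1
  ring

/-- `p^{1/4}·p^{1/4} = √p` and `p^{1/4}·(¼p^{−3/4}·2x) = x/(2√p)` for `p > 0` (plumbing). [folklore] -/
private theorem rpow_quarter_identities {P x : ℝ} (hP : 0 < P) :
    P ^ (1 / 4 : ℝ) * P ^ (1 / 4 : ℝ) = Real.sqrt P ∧
      P ^ (1 / 4 : ℝ) * ((1 / 4 : ℝ) * P ^ ((1 / 4 : ℝ) - 1) * (2 * x)) =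
        x / (2 * Real.sqrt P) := by
  have hs : Real.sqrt P = P ^ (1 / 2 : ℝ) := Real.sqrt_eq_rpow P
  constructor
  · rw [← Real.rpow_add hP, hs]; norm_num
  · have h1 : P ^ (1 / 4 : ℝ) * P ^ ((1 / 4 : ℝ) - 1) = P ^ (-(1 / 2) : ℝ) := by
      rw [← Real.rpow_add hP]; norm_num
    have h2 : P ^ (-(1 / 2) : ℝ) = (Real.sqrt P)⁻¹ := by
      rw [Real.rpow_neg hP.le, hs]
    calc P ^ (1 / 4 : ℝ) * ((1 / 4 : ℝ) * P ^ ((1 / 4 : ℝ) - 1) * (2 * x))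
        = (P ^ (1 / 4 : ℝ) * P ^ ((1 / 4 : ℝ) - 1)) * (x / 2) := by ring
      _ = x / (2 * Real.sqrt P) := by rw [h1, h2]; field_simp

/-- A property of `w` on `(λ, ∞)` only: `IsRiccatiSol` is invariant under modification off
`(λ, ∞)` (plumbing). [folklore] -/
private theorem isRiccatiSol_congr {w₁ w₂ : ℝ → ℂ} (heq : EqOn w₁ w₂ (Ioi lam))
    (h : IsRiccatiSol lam w₂) : IsRiccatiSol lam w₁ := by
  refine ⟨h.1.congr fun x hx => heq hx, fun x hx => ?_⟩
  have hev : w₁ =ᶠ[𝓝 x] w₂ := Filter.eventually_of_mem (isOpen_Ioi.mem_nhds hx) fun y hy => heq hy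
  have := h.2 x hx
  unfold opNabla at this ⊢
  rw [hev.deriv_eq, heq hx]
  exact this

/-- **The Riccati equation from a zero-free solution** (Lemma 4.2 (ii), core): if `(U, U′, U″)`
solve `p U″ + 2x U′ + V U = 0` on `(λ, ∞)` (complex-valued) with `U ≠ 0` there, then
`w = x/(2√p) + √p·U′/U` (`= p^{1/4}∂(p^{1/4}U)/U`) solves the Riccati equation (4.2)
`∇w + w² = −V + (p″/4 − p′²/(16p))`. [cite: ConnesMoscovici2022, Lemma 4.2 (ii) (= arXiv Lemma 5.2 (ii), chunk p0010:L41–L47; proof L62–L75)] -/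
theorem isRiccatiSol_logDeriv (hlam : 0 < lam) {U Ud Udd : ℝ → ℂ}
    (h : ∀ x ∈ Ioi lam, HasDerivAt U (Ud x) x ∧ HasDerivAt Ud (Udd x) x ∧
      ((pOut lam x : ℝ) : ℂ) * Udd x + 2 * (x : ℂ) * Ud x + ((vPot lam x : ℝ) : ℂ) * U x = 0)
    (hU : ∀ x ∈ Ioi lam, U x ≠ 0) :
    IsRiccatiSol lam fun x =>
      ((x / (2 * Real.sqrt (pOut lam x)) : ℝ) : ℂ) + ((Real.sqrt (pOut lam x) : ℝ) : ℂ) * (Ud x / U x) := by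
  have hderiv : ∀ x ∈ Ioi lam, HasDerivAt (fun x =>
      ((x / (2 * Real.sqrt (pOut lam x)) : ℝ) : ℂ) + ((Real.sqrt (pOut lam x) : ℝ) : ℂ) * (Ud x / U x))
      ((((1 * (2 * Real.sqrt (pOut lam x)) - x * (2 * (x / Real.sqrt (pOut lam x)))) /
          (2 * Real.sqrt (pOut lam x)) ^ 2 : ℝ) : ℂ) +
        ((((x / Real.sqrt (pOut lam x)) : ℝ) : ℂ) * (Ud x / U x) +
          ((Real.sqrt (pOut lam x) : ℝ) : ℂ) * ((Udd x * U x - Ud x * Ud x) / U x ^ 2))) x := by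
    intro x hx
    obtain ⟨h1, h2, -⟩ := h x hx
    have hs0 : 0 < Real.sqrt (pOut lam x) := Real.sqrt_pos.2 (pOut_pos' hlam hx)
    have hsd := hasDerivAt_sqrt_pOut' hlam hx
    have ha : HasDerivAt (fun y : ℝ => y / (2 * Real.sqrt (pOut lam y)))
        ((1 * (2 * Real.sqrt (pOut lam x)) - x * (2 * (x / Real.sqrt (pOut lam x)))) /
          (2 * Real.sqrt (pOut lam x)) ^ 2) x :=
      (hasDerivAt_id x).div (hsd.const_mul 2) (by positivity)
    have hq : HasDerivAt (fun y => Ud y / U y) ((Udd x * U x - Ud x * Ud x) / U x ^ 2) x :=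
      h2.div h1 (hU x hx)
    exact ha.ofReal_comp.add (hsd.ofReal_comp.mul hq)
  refine ⟨fun x hx => (hderiv x hx).differentiableAt.differentiableWithinAt, fun x hx => ?_⟩
  obtain ⟨-, -, hode⟩ := h x hx
  have hp0 := pOut_pos' hlam hx
  have hs0 : 0 < Real.sqrt (pOut lam x) := Real.sqrt_pos.2 hp0
  have hUx := hU x hx
  unfold opNabla
  rw [(hderiv x hx).deriv]
  set S : ℂ := ((Real.sqrt (pOut lam x) : ℝ) : ℂ) with hS
  have hS0 : S ≠ 0 := by rw [hS]; exact_mod_cast hs0.ne'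
  have hS2 : ((pOut lam x : ℝ) : ℂ) = S ^ 2 := by
    rw [hS]; exact_mod_cast (Real.sq_sqrt hp0.le).symm
  have hUdd : Udd x = -(2 * (x : ℂ) * Ud x + ((vPot lam x : ℝ) : ℂ) * U x) / S ^ 2 := by
    rw [← hS2]
    have hp0c : ((pOut lam x : ℝ) : ℂ) ≠ 0 := by exact_mod_cast hp0.ne'
    field_simp
    linear_combination hode
  rw [hUdd]
  push_cast
  rw [hS2, ← hS]
  field_simp
  ring

/-- For real `C²` solutions `u₁, u₂` and `z ∈ ℂ`: the data `(U, U′, U″)` of `U = u₁ + z u₂`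
(plumbing). [folklore] -/
private theorem complexSol_add_mul {u₁ u₂ : ℝ → ℝ}
    (hu₁ : ContDiffOn ℝ 2 u₁ (Ioi lam)) (hu₂ : ContDiffOn ℝ 2 u₂ (Ioi lam))
    (hL₁ : ∀ x ∈ Ioi lam, opL lam (fun y ↦ (u₁ y : ℂ)) x = 0)
    (hL₂ : ∀ x ∈ Ioi lam, opL lam (fun y ↦ (u₂ y : ℂ)) x = 0) (z : ℂ) {x : ℝ} (hx : x ∈ Ioi lam) :
    HasDerivAt (fun y => (u₁ y : ℂ) + z * u₂ y) (((deriv u₁ x : ℝ) : ℂ) + z * ((deriv u₂ x : ℝ) : ℂ)) x ∧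
    HasDerivAt (fun y => ((deriv u₁ y : ℝ) : ℂ) + z * ((deriv u₂ y : ℝ) : ℂ))
      (((deriv (deriv u₁) x : ℝ) : ℂ) + z * ((deriv (deriv u₂) x : ℝ) : ℂ)) x ∧
    ((pOut lam x : ℝ) : ℂ) * (((deriv (deriv u₁) x : ℝ) : ℂ) + z * ((deriv (deriv u₂) x : ℝ) : ℂ)) +
      2 * (x : ℂ) * (((deriv u₁ x : ℝ) : ℂ) + z * ((deriv u₂ x : ℝ) : ℂ)) +
      ((vPot lam x : ℝ) : ℂ) * ((u₁ x : ℂ) + z * u₂ x) = 0 := by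
  obtain ⟨h11, h12⟩ := hasDerivAt_of_contDiffOn_two hu₁ hx
  obtain ⟨h21, h22⟩ := hasDerivAt_of_contDiffOn_two hu₂ hx
  have hode₁ := realODE_of_opL_eq_zero hu₁ hL₁ hx
  have hode₂ := realODE_of_opL_eq_zero hu₂ hL₂ hx
  refine ⟨h11.ofReal_comp.add (h21.ofReal_comp.const_mul z),
    h12.ofReal_comp.add (h22.ofReal_comp.const_mul z), ?_⟩
  have e₁ : ((pOut lam x : ℝ) : ℂ) * ((deriv (deriv u₁) x : ℝ) : ℂ) + 2 * (x : ℂ) * ((deriv u₁ x : ℝ) : ℂ) +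
      ((vPot lam x : ℝ) : ℂ) * (u₁ x : ℂ) = 0 := by exact_mod_cast hode₁
  have e₂ : ((pOut lam x : ℝ) : ℂ) * ((deriv (deriv u₂) x : ℝ) : ℂ) + 2 * (x : ℂ) * ((deriv u₂ x : ℝ) : ℂ) +
      ((vPot lam x : ℝ) : ℂ) * (u₂ x : ℂ) = 0 := by exact_mod_cast hode₂
  linear_combination e₁ + z * e₂

/-- The typed expression `p^{1/4}∂(p^{1/4}u)/u` of Lemma 4.2 (ii) equals `x/(2√p) + √p·u′/u` on
`(λ, ∞)` for `u = u₁ + z u₂`. [cite: ConnesMoscovici2022, Lemma 4.2 (ii) (= arXiv Lemma 5.2 (ii), chunk p0010:L41–L47)] -/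
theorem wz_eq_logDeriv (hlam : 0 < lam) {u₁ u₂ : ℝ → ℝ}
    (hu₁ : ContDiffOn ℝ 2 u₁ (Ioi lam)) (hu₂ : ContDiffOn ℝ 2 u₂ (Ioi lam))
    (hL₁ : ∀ x ∈ Ioi lam, opL lam (fun y ↦ (u₁ y : ℂ)) x = 0)
    (hL₂ : ∀ x ∈ Ioi lam, opL lam (fun y ↦ (u₂ y : ℂ)) x = 0) (z : ℂ) {x : ℝ} (hx : x ∈ Ioi lam)
    (hUx : (u₁ x : ℂ) + z * u₂ x ≠ 0) :
    (((pOut lam x) ^ (1 / 4 : ℝ) : ℝ) : ℂ) *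
        deriv (fun y ↦ (((pOut lam y) ^ (1 / 4 : ℝ) : ℝ) : ℂ) * ((u₁ y : ℂ) + z * u₂ y)) x /
        ((u₁ x : ℂ) + z * u₂ x) =
      ((x / (2 * Real.sqrt (pOut lam x)) : ℝ) : ℂ) + ((Real.sqrt (pOut lam x) : ℝ) : ℂ) *
        ((((deriv u₁ x : ℝ) : ℂ) + z * ((deriv u₂ x : ℝ) : ℂ)) / ((u₁ x : ℂ) + z * u₂ x)) := by
  obtain ⟨h1, -, -⟩ := complexSol_add_mul hu₁ hu₂ hL₁ hL₂ z hx
  have hr := hasDerivAt_rpow_quarter hlam hx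
  have hprod : HasDerivAt (fun y ↦ (((pOut lam y) ^ (1 / 4 : ℝ) : ℝ) : ℂ) * ((u₁ y : ℂ) + z * u₂ y))
      (((((1 / 4 : ℝ) * (pOut lam x) ^ ((1 / 4 : ℝ) - 1) * (2 * x) : ℝ) : ℂ)) *
          ((u₁ x : ℂ) + z * u₂ x) +
        (((pOut lam x) ^ (1 / 4 : ℝ) : ℝ) : ℂ) * (((deriv u₁ x : ℝ) : ℂ) + z * ((deriv u₂ x : ℝ) : ℂ))) x :=
    hr.ofReal_comp.mul h1
  rw [hprod.deriv]
  obtain ⟨e1, e2⟩ := rpow_quarter_identities (x := x) (pOut_pos' hlam hx)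
  have e1c : (((pOut lam x) ^ (1 / 4 : ℝ) : ℝ) : ℂ) * (((pOut lam x) ^ (1 / 4 : ℝ) : ℝ) : ℂ) =
      ((Real.sqrt (pOut lam x) : ℝ) : ℂ) := by exact_mod_cast e1
  have e2c : (((pOut lam x) ^ (1 / 4 : ℝ) : ℝ) : ℂ) *
      ((((1 / 4 : ℝ) * (pOut lam x) ^ ((1 / 4 : ℝ) - 1) * (2 * x) : ℝ) : ℂ)) =
      ((x / (2 * Real.sqrt (pOut lam x)) : ℝ) : ℂ) := by exact_mod_cast e2
  set r : ℂ := (((pOut lam x) ^ (1 / 4 : ℝ) : ℝ) : ℂ) with hr_def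
  set r1 : ℂ := (((1 / 4 : ℝ) * (pOut lam x) ^ ((1 / 4 : ℝ) - 1) * (2 * x) : ℝ) : ℂ) with hr1_def
  set U : ℂ := ((u₁ x : ℂ) + z * (u₂ x : ℂ)) with hU_def
  set Ud : ℂ := (((deriv u₁ x : ℝ) : ℂ) + z * ((deriv u₂ x : ℝ) : ℂ)) with hUd_def
  rw [show r * (r1 * U + r * Ud) = (r * r1) * U + (r * r) * Ud by ring, e2c, e1c, add_div,
    mul_div_cancel_right₀ _ hUx, mul_div_assoc]

/-- **Lemma 4.2 (ii)**: for `z ∉ ℝ`, `w_z = p^{1/4}∂(p^{1/4}u)/u`, `u = u₁ + zu₂`, solves the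
Riccati equation (4.2). [cite: ConnesMoscovici2022, Lemma 4.2 (ii) (= arXiv Lemma 5.2 (ii), chunk p0010:L41–L47; proof L62–L75)] -/
theorem isRiccatiSol_wz (hlam : 0 < lam) {u₁ u₂ : ℝ → ℝ}
    (hu₁ : ContDiffOn ℝ 2 u₁ (Ioi lam)) (hu₂ : ContDiffOn ℝ 2 u₂ (Ioi lam))
    (hL₁ : ∀ x ∈ Ioi lam, opL lam (fun y ↦ (u₁ y : ℂ)) x = 0)
    (hL₂ : ∀ x ∈ Ioi lam, opL lam (fun y ↦ (u₂ y : ℂ)) x = 0) {z : ℂ}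
    (hUz : ∀ x ∈ Ioi lam, (u₁ x : ℂ) + z * u₂ x ≠ 0) :
    IsRiccatiSol lam fun x ↦
      (((pOut lam x) ^ (1 / 4 : ℝ) : ℝ) : ℂ) *
        deriv (fun y ↦ (((pOut lam y) ^ (1 / 4 : ℝ) : ℝ) : ℂ) * ((u₁ y : ℂ) + z * u₂ y)) x /
        ((u₁ x : ℂ) + z * u₂ x) := by
  refine isRiccatiSol_congr (fun x hx => wz_eq_logDeriv hlam hu₁ hu₂ hL₁ hL₂ z hx (hUz x hx)) ?_
  exact isRiccatiSol_logDeriv hlam (fun x hx => complexSol_add_mul hu₁ hu₂ hL₁ hL₂ z hx) hUz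

/-! ### Clause (iii): every solution of the Riccati equation is `w_z` for a unique `z ∉ ℝ` -/

/-- Data `(U, U′, U″)` of `U = c₁u₁ + c₂u₂` for real `C²` solutions `u₁, u₂` (plumbing). [folklore] -/
private theorem complexSol_lin {u₁ u₂ : ℝ → ℝ}
    (hu₁ : ContDiffOn ℝ 2 u₁ (Ioi lam)) (hu₂ : ContDiffOn ℝ 2 u₂ (Ioi lam))
    (hL₁ : ∀ x ∈ Ioi lam, opL lam (fun y ↦ (u₁ y : ℂ)) x = 0)
    (hL₂ : ∀ x ∈ Ioi lam, opL lam (fun y ↦ (u₂ y : ℂ)) x = 0) (c₁ c₂ : ℂ) {x : ℝ}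
    (hx : x ∈ Ioi lam) :
    HasDerivAt (fun y => c₁ * (u₁ y : ℂ) + c₂ * (u₂ y : ℂ))
      (c₁ * ((deriv u₁ x : ℝ) : ℂ) + c₂ * ((deriv u₂ x : ℝ) : ℂ)) x ∧
    HasDerivAt (fun y => c₁ * ((deriv u₁ y : ℝ) : ℂ) + c₂ * ((deriv u₂ y : ℝ) : ℂ))
      (c₁ * ((deriv (deriv u₁) x : ℝ) : ℂ) + c₂ * ((deriv (deriv u₂) x : ℝ) : ℂ)) x ∧
    ((pOut lam x : ℝ) : ℂ) * (c₁ * ((deriv (deriv u₁) x : ℝ) : ℂ) + c₂ * ((deriv (deriv u₂) x : ℝ) : ℂ)) +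
      2 * (x : ℂ) * (c₁ * ((deriv u₁ x : ℝ) : ℂ) + c₂ * ((deriv u₂ x : ℝ) : ℂ)) +
      ((vPot lam x : ℝ) : ℂ) * (c₁ * (u₁ x : ℂ) + c₂ * (u₂ x : ℂ)) = 0 := by
  obtain ⟨h11, h12⟩ := hasDerivAt_of_contDiffOn_two hu₁ hx
  obtain ⟨h21, h22⟩ := hasDerivAt_of_contDiffOn_two hu₂ hx
  have hode₁ := realODE_of_opL_eq_zero hu₁ hL₁ hx
  have hode₂ := realODE_of_opL_eq_zero hu₂ hL₂ hx
  refine ⟨(h11.ofReal_comp.const_mul c₁).add (h21.ofReal_comp.const_mul c₂),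
    (h12.ofReal_comp.const_mul c₁).add (h22.ofReal_comp.const_mul c₂), ?_⟩
  have e₁ : ((pOut lam x : ℝ) : ℂ) * ((deriv (deriv u₁) x : ℝ) : ℂ) +
      2 * (x : ℂ) * ((deriv u₁ x : ℝ) : ℂ) + ((vPot lam x : ℝ) : ℂ) * (u₁ x : ℂ) = 0 := by
    exact_mod_cast hode₁
  have e₂ : ((pOut lam x : ℝ) : ℂ) * ((deriv (deriv u₂) x : ℝ) : ℂ) +
      2 * (x : ℂ) * ((deriv u₂ x : ℝ) : ℂ) + ((vPot lam x : ℝ) : ℂ) * (u₂ x : ℂ) = 0 := by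
    exact_mod_cast hode₂
  linear_combination c₁ * e₁ + c₂ * e₂

/-- From the data form `p U″ + 2x U′ + V U = 0` to the tree's first-order form
`dU′/dt = P U′ + Q U`, `P = −2x/p`, `Q = −V/p` (plumbing). [folklore] -/
private theorem treeForm (hlam : 0 < lam) {U Ud Udd : ℝ → ℂ}
    (h : ∀ x ∈ Ioi lam, HasDerivAt U (Ud x) x ∧ HasDerivAt Ud (Udd x) x ∧
      ((pOut lam x : ℝ) : ℂ) * Udd x + 2 * (x : ℂ) * Ud x + ((vPot lam x : ℝ) : ℂ) * U x = 0)
    {t : ℝ} (ht : t ∈ Ioi lam) :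
    HasDerivAt U (Ud t) t ∧
      HasDerivAt Ud ((-(2 * (t : ℂ)) / ((pOut lam t : ℝ) : ℂ)) * Ud t +
        (-((vPot lam t : ℝ) : ℂ) / ((pOut lam t : ℝ) : ℂ)) * U t) t := by
  obtain ⟨h1, h2, hode⟩ := h t ht
  refine ⟨h1, h2.congr_deriv ?_⟩
  have hp : ((pOut lam t : ℝ) : ℂ) ≠ 0 := by exact_mod_cast (pOut_pos' hlam ht).ne'
  field_simp
  linear_combination hode

/-- **Every solution is a combination of `u₁, u₂`** (uniqueness for the linear equation, the
tree's `Literature.Analysis.ODE.eqOn_of_solution_Ioo`, Hartman IV Lemma 1.1): complex solution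
data `(U, U′, U″)` on `(λ, ∞)` coincide with `c₁u₁ + c₂u₂` for the constants matching the data at
one point. [cite: ConnesMoscovici2022, Lemma 4.2 proof (= arXiv Lemma 5.2, chunk p0010:L62–L86)] -/
theorem eq_lin_of_complexSol (hlam : 0 < lam) {u₁ u₂ : ℝ → ℝ}
    (hu₁ : ContDiffOn ℝ 2 u₁ (Ioi lam)) (hu₂ : ContDiffOn ℝ 2 u₂ (Ioi lam))
    (hL₁ : ∀ x ∈ Ioi lam, opL lam (fun y ↦ (u₁ y : ℂ)) x = 0)
    (hL₂ : ∀ x ∈ Ioi lam, opL lam (fun y ↦ (u₂ y : ℂ)) x = 0)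
    (hW : ∃ x ∈ Ioi lam, u₁ x * deriv u₂ x - u₂ x * deriv u₁ x ≠ 0) {U Ud Udd : ℝ → ℂ}
    (h : ∀ x ∈ Ioi lam, HasDerivAt U (Ud x) x ∧ HasDerivAt Ud (Udd x) x ∧
      ((pOut lam x : ℝ) : ℂ) * Udd x + 2 * (x : ℂ) * Ud x + ((vPot lam x : ℝ) : ℂ) * U x = 0) :
    ∃ c₁ c₂ : ℂ, ∀ x ∈ Ioi lam, U x = c₁ * (u₁ x : ℂ) + c₂ * (u₂ x : ℂ) ∧
      Ud x = c₁ * ((deriv u₁ x : ℝ) : ℂ) + c₂ * ((deriv u₂ x : ℝ) : ℂ) := by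
  set x₀ : ℝ := lam + 1 with hx₀_def
  have hx₀ : x₀ ∈ Ioi lam := by simp [hx₀_def]
  have hW₀ := wronskian_ne_zero hlam hu₁ hu₂ hL₁ hL₂ hW hx₀
  set W₀ : ℝ := u₁ x₀ * deriv u₂ x₀ - u₂ x₀ * deriv u₁ x₀ with hW₀_def
  have hW₀c : (W₀ : ℂ) ≠ 0 := by exact_mod_cast hW₀
  -- Cramer
  set c₁ : ℂ := (U x₀ * ((deriv u₂ x₀ : ℝ) : ℂ) - Ud x₀ * (u₂ x₀ : ℂ)) / (W₀ : ℂ) with hc₁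
  set c₂ : ℂ := (Ud x₀ * (u₁ x₀ : ℂ) - U x₀ * ((deriv u₁ x₀ : ℝ) : ℂ)) / (W₀ : ℂ) with hc₂
  refine ⟨c₁, c₂, fun x hx => ?_⟩
  -- uniqueness on `(λ, b)` with `b` beyond `x` and `x₀`
  set b : ℝ := max x x₀ + 1 with hb
  have hxb : x ∈ Ioo lam b := ⟨hx, by rw [hb]; linarith [le_max_left x x₀]⟩
  have hx₀b : x₀ ∈ Ioo lam b := ⟨hx₀, by rw [hb]; linarith [le_max_right x x₀]⟩
  have hsub : Ioo lam b ⊆ Ioi lam := fun t ht => ht.1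
  have hpc : Continuous fun t : ℝ => ((pOut lam t : ℝ) : ℂ) := by
    unfold pOut; fun_prop
  have hP : ContinuousOn (fun t : ℝ => (-(2 * (t : ℂ)) / ((pOut lam t : ℝ) : ℂ))) (Ioo lam b) := by
    refine ContinuousOn.div (by fun_prop) hpc.continuousOn fun t ht => ?_
    exact_mod_cast (pOut_pos' hlam (hsub ht)).ne'
  have hQ : ContinuousOn (fun t : ℝ => (-((vPot lam t : ℝ) : ℂ) / ((pOut lam t : ℝ) : ℂ)))
      (Ioo lam b) := by
    have hVc : Continuous fun t : ℝ => ((vPot lam t : ℝ) : ℂ) := by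
      unfold vPot; fun_prop
    refine ContinuousOn.div hVc.neg.continuousOn hpc.continuousOn fun t ht => ?_
    exact_mod_cast (pOut_pos' hlam (hsub ht)).ne'
  have hlin := fun t (ht : t ∈ Ioi lam) => complexSol_lin hu₁ hu₂ hL₁ hL₂ c₁ c₂ ht
  have huniq := Literature.Analysis.ODE.eqOn_of_solution_Ioo hP hQ hx₀b
    (fun t ht => treeForm hlam h (hsub ht)) (fun t ht => treeForm hlam hlin (hsub ht)) ?_ ?_
  · exact ⟨huniq.1 hxb, huniq.2 hxb⟩
  · simp only [hc₁, hc₂]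
    field_simp
    rw [hW₀_def]
    push_cast
    ring
  · simp only [hc₁, hc₂]
    field_simp
    rw [hW₀_def]
    push_cast
    ring

/-- **Lemma 4.2 (iii)** (core): every solution `w` of the Riccati equation (4.2) on `(λ, ∞)` is
`w_z` for a unique `z ∉ ℝ`.  Proof: `u = exp ∫(w − x/(2√p))/√p` solves `Lu = 0` (the computation of
(ii) run backwards) and has no zero; by uniqueness for the linear equation `u = c₁u₁ + c₂u₂`; `c₁ ≠ 0`
and `z = c₂/c₁ ∉ ℝ` because real solutions oscillate (clause (i)); `z` is unique since
`w_z(x₀) = w_{z′}(x₀)` forces `(z − z′)·W(x₀) = 0`. [cite: ConnesMoscovici2022, Lemma 4.2 (iii) (= arXiv Lemma 5.2 (ii)–(iii), chunk p0010:L41–L47; proof L62–L86)] -/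
theorem existsUnique_z_of_isRiccatiSol (hlam : 0 < lam) {u₁ u₂ : ℝ → ℝ}
    (hu₁ : ContDiffOn ℝ 2 u₁ (Ioi lam)) (hu₂ : ContDiffOn ℝ 2 u₂ (Ioi lam))
    (hL₁ : ∀ x ∈ Ioi lam, opL lam (fun y ↦ (u₁ y : ℂ)) x = 0)
    (hL₂ : ∀ x ∈ Ioi lam, opL lam (fun y ↦ (u₂ y : ℂ)) x = 0)
    (hW : ∃ x ∈ Ioi lam, u₁ x * deriv u₂ x - u₂ x * deriv u₁ x ≠ 0) {w : ℝ → ℂ}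
    (hw : IsRiccatiSol lam w) :
    ∃! z : ℂ, z.im ≠ 0 ∧ ∀ x ∈ Ioi lam,
      w x = (((pOut lam x) ^ (1 / 4 : ℝ) : ℝ) : ℂ) *
          deriv (fun y ↦ (((pOut lam y) ^ (1 / 4 : ℝ) : ℝ) : ℂ) * ((u₁ y : ℂ) + z * u₂ y)) x /
          ((u₁ x : ℂ) + z * u₂ x) := by
  obtain ⟨hwd, hRic⟩ := hw
  -- notation: `s = √p`, `a = x/(2s)`, `y = (w − a)/s`
  set s : ℝ → ℝ := fun x => Real.sqrt (pOut lam x) with hs_def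
  set a : ℝ → ℝ := fun x => x / (2 * s x) with ha_def
  set y : ℝ → ℂ := fun x => (w x - (a x : ℂ)) / (s x : ℂ) with hy_def
  have hs0 : ∀ x ∈ Ioi lam, 0 < s x := fun x hx => Real.sqrt_pos.2 (pOut_pos' hlam hx)
  have hs2 : ∀ x ∈ Ioi lam, ((s x : ℝ) : ℂ) ^ 2 = ((pOut lam x : ℝ) : ℂ) := fun x hx => by
    exact_mod_cast Real.sq_sqrt (pOut_pos' hlam hx).le
  have hsc : Continuous s := by
    simp only [hs_def]; unfold pOut; fun_prop
  have hw_cont : ContinuousOn w (Ioi lam) := hwd.continuousOn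
  have ha_cont : ContinuousOn a (Ioi lam) := by
    simp only [ha_def]
    exact continuousOn_id.div (continuousOn_const.mul hsc.continuousOn)
      fun x hx => by have := hs0 x hx; positivity
  have hy_cont : ContinuousOn y (Ioi lam) := by
    simp only [hy_def]
    refine (hw_cont.sub (Complex.continuous_ofReal.comp_continuousOn ha_cont)).div
      (Complex.continuous_ofReal.comp_continuousOn hsc.continuousOn) fun x hx => ?_
    exact_mod_cast (hs0 x hx).ne'
  -- derivatives of `a`, `s`, `w`, `y` on `(λ, ∞)`
  have hsd : ∀ x ∈ Ioi lam, HasDerivAt s (x / s x) x := fun x hx => hasDerivAt_sqrt_pOut' hlam hx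
  have had : ∀ x ∈ Ioi lam, HasDerivAt a
      ((1 * (2 * s x) - x * (2 * (x / s x))) / (2 * s x) ^ 2) x := fun x hx =>
    (hasDerivAt_id x).div ((hsd x hx).const_mul 2) (by have := hs0 x hx; positivity)
  have hwd' : ∀ x ∈ Ioi lam, HasDerivAt w (deriv w x) x := fun x hx =>
    (hwd.differentiableAt (isOpen_Ioi.mem_nhds hx)).hasDerivAt
  set y' : ℝ → ℂ := fun x =>
    ((deriv w x - (((1 * (2 * s x) - x * (2 * (x / s x))) / (2 * s x) ^ 2 : ℝ) : ℂ)) * (s x : ℂ) -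
      (w x - (a x : ℂ)) * ((x / s x : ℝ) : ℂ)) / (s x : ℂ) ^ 2 with hy'_def
  have hyd : ∀ x ∈ Ioi lam, HasDerivAt y (y' x) x := fun x hx =>
    ((hwd' x hx).sub (had x hx).ofReal_comp).div (hsd x hx).ofReal_comp
      (by exact_mod_cast (hs0 x hx).ne')
  -- the primitive `Θ` of `y` and `u = exp Θ`
  set x₀ : ℝ := lam + 1 with hx₀_def
  have hx₀ : x₀ ∈ Ioi lam := by simp [hx₀_def]
  set Θ : ℝ → ℂ := fun x => ∫ t in x₀..x, y t with hΘ_def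
  have hΘd : ∀ x ∈ Ioi lam, HasDerivAt Θ (y x) x := by
    intro x hx
    have hsub : uIcc x₀ x ⊆ Ioi lam := (ordConnected_Ioi.uIcc_subset hx₀ hx)
    exact intervalIntegral.integral_hasDerivAt_right ((hy_cont.mono hsub).intervalIntegrable)
      (hy_cont.stronglyMeasurableAtFilter isOpen_Ioi x hx) (hy_cont.continuousAt (isOpen_Ioi.mem_nhds hx))
  set u : ℝ → ℂ := fun x => Complex.exp (Θ x) with hu_def
  set ud : ℝ → ℂ := fun x => y x * u x with hud_def
  set udd : ℝ → ℂ := fun x => y' x * u x + y x * ud x with hudd_def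
  have hu0 : ∀ x, u x ≠ 0 := fun x => Complex.exp_ne_zero _
  have hud1 : ∀ x ∈ Ioi lam, HasDerivAt u (ud x) x := fun x hx =>
    ((hΘd x hx).cexp).congr_deriv (by simp only [hud_def, hu_def]; ring)
  have hud2 : ∀ x ∈ Ioi lam, HasDerivAt ud (udd x) x := fun x hx =>
    ((hyd x hx).mul (hud1 x hx)).congr_deriv (by simp only [hudd_def])
  -- `u` solves `Lu = 0` (the Riccati equation for `w = a + s·y`, read backwards)
  have hsol : ∀ x ∈ Ioi lam, HasDerivAt u (ud x) x ∧ HasDerivAt ud (udd x) x ∧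
      ((pOut lam x : ℝ) : ℂ) * udd x + 2 * (x : ℂ) * ud x + ((vPot lam x : ℝ) : ℂ) * u x = 0 := by
    intro x hx
    refine ⟨hud1 x hx, hud2 x hx, ?_⟩
    have hR := hRic x hx
    unfold opNabla at hR
    have hS0 : ((s x : ℝ) : ℂ) ≠ 0 := by exact_mod_cast (hs0 x hx).ne'
    have hP : ((pOut lam x : ℝ) : ℂ) = ((s x : ℝ) : ℂ) ^ 2 := (hs2 x hx).symm
    have hw' : deriv w x = (-((vPot lam x : ℝ) : ℂ) +
        (((2 : ℝ) / 4 - (2 * x) ^ 2 / (16 * pOut lam x) : ℝ) : ℂ) - w x ^ 2) / ((s x : ℝ) : ℂ) := by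
      rw [eq_div_iff hS0]
      linear_combination hR
    simp only [hudd_def, hud_def, hy'_def, hy_def, ha_def]
    rw [hw']
    push_cast
    rw [hP]
    field_simp
    ring
  -- `u = c₁u₁ + c₂u₂`
  obtain ⟨c₁, c₂, hc⟩ := eq_lin_of_complexSol hlam hu₁ hu₂ hL₁ hL₂ hW hsol
  -- `c₁ ≠ 0`: otherwise `u = c₂u₂` vanishes where `u₂` does
  have hreal₂ : ∀ x ∈ Ioi lam, HasDerivAt u₂ (deriv u₂ x) x ∧
      HasDerivAt (deriv u₂) (deriv (deriv u₂) x) x ∧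
      pOut lam x * deriv (deriv u₂) x + 2 * x * deriv u₂ x + vPot lam x * u₂ x = 0 := fun x hx =>
    ⟨(hasDerivAt_of_contDiffOn_two hu₂ hx).1, (hasDerivAt_of_contDiffOn_two hu₂ hx).2,
      realODE_of_opL_eq_zero hu₂ hL₂ hx⟩
  have hc₁ : c₁ ≠ 0 := by
    intro h0
    obtain ⟨t, ht, ht0⟩ := (infinite_zeros_of_realODE hlam hreal₂).nonempty
    have := (hc t ht).1
    rw [h0, ht0] at this
    simp at this
    exact hu0 t this
  set z : ℂ := c₂ / c₁ with hz_def
  have hUz : ∀ x ∈ Ioi lam, u x = c₁ * ((u₁ x : ℂ) + z * u₂ x) := fun x hx => by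
    rw [(hc x hx).1, hz_def]; field_simp
  have hUdz : ∀ x ∈ Ioi lam, ud x = c₁ * (((deriv u₁ x : ℝ) : ℂ) + z * ((deriv u₂ x : ℝ) : ℂ)) :=
    fun x hx => by rw [(hc x hx).2, hz_def]; field_simp
  -- `z ∉ ℝ`: otherwise `u₁ + z u₂` is a real solution and vanishes somewhere
  have hzim : z.im ≠ 0 := by
    intro him
    obtain ⟨t, ht, ht0⟩ := (infinite_zeros_add_mul hlam hu₁ hu₂ hL₁ hL₂ z.re).nonempty
    have hzre : z = (z.re : ℂ) := Complex.ext (by simp) (by simp [him])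
    have : u t = 0 := by
      rw [hUz t ht, hzre]
      have : (u₁ t : ℂ) + (z.re : ℂ) * (u₂ t : ℂ) = ((u₁ t + z.re * u₂ t : ℝ) : ℂ) := by push_cast; ring
      rw [this, ht0]; simp
    exact hu0 t this
  have hUzne : ∀ x ∈ Ioi lam, (u₁ x : ℂ) + z * u₂ x ≠ 0 := fun x hx =>
    add_mul_ne_zero_of_im_ne_zero hlam hu₁ hu₂ hL₁ hL₂ hW hzim hx
  -- `w = a + s·(u′/u) = w_z`
  have hwz : ∀ x ∈ Ioi lam, w x = (((pOut lam x) ^ (1 / 4 : ℝ) : ℝ) : ℂ) *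
      deriv (fun y ↦ (((pOut lam y) ^ (1 / 4 : ℝ) : ℝ) : ℂ) * ((u₁ y : ℂ) + z * u₂ y)) x /
      ((u₁ x : ℂ) + z * u₂ x) := by
    intro x hx
    rw [wz_eq_logDeriv hlam hu₁ hu₂ hL₁ hL₂ z hx (hUzne x hx)]
    have hS0 : ((s x : ℝ) : ℂ) ≠ 0 := by exact_mod_cast (hs0 x hx).ne'
    have hq : (((deriv u₁ x : ℝ) : ℂ) + z * ((deriv u₂ x : ℝ) : ℂ)) / ((u₁ x : ℂ) + z * u₂ x) = y x := by
      have e1 : y x = ud x / u x := by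
        simp only [hud_def]; rw [mul_div_cancel_right₀ _ (hu0 x)]
      rw [e1, hUz x hx, hUdz x hx, mul_div_mul_left _ _ hc₁]
    rw [hq]
    have hS0' : ((Real.sqrt (pOut lam x) : ℝ) : ℂ) ≠ 0 := hS0
    simp only [hy_def, ha_def, hs_def]
    rw [← mul_div_assoc, mul_div_cancel_left₀ _ hS0']
    ring
  refine ⟨z, ⟨hzim, hwz⟩, fun z' hz' => ?_⟩
  -- uniqueness: compare at `x₀`
  obtain ⟨hz'im, hwz'⟩ := hz'
  have hUz'ne := add_mul_ne_zero_of_im_ne_zero hlam hu₁ hu₂ hL₁ hL₂ hW hz'im hx₀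
  have e := (hwz' x₀ hx₀).symm.trans (hwz x₀ hx₀)
  rw [wz_eq_logDeriv hlam hu₁ hu₂ hL₁ hL₂ z' hx₀ hUz'ne,
    wz_eq_logDeriv hlam hu₁ hu₂ hL₁ hL₂ z hx₀ (hUzne x₀ hx₀)] at e
  have hS0 : ((s x₀ : ℝ) : ℂ) ≠ 0 := by exact_mod_cast (hs0 x₀ hx₀).ne'
  have e2 := mul_left_cancel₀ hS0 (add_left_cancel e)
  rw [div_eq_div_iff hUz'ne (hUzne x₀ hx₀)] at e2
  have hWc : ((u₁ x₀ * deriv u₂ x₀ - u₂ x₀ * deriv u₁ x₀ : ℝ) : ℂ) ≠ 0 := by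
    exact_mod_cast wronskian_ne_zero hlam hu₁ hu₂ hL₁ hL₂ hW hx₀
  have key : (z' - z) * ((u₁ x₀ * deriv u₂ x₀ - u₂ x₀ * deriv u₁ x₀ : ℝ) : ℂ) = 0 := by
    push_cast
    linear_combination e2
  exact sub_eq_zero.mp ((mul_eq_zero.mp key).resolve_right hWc)

/-! ### The discharge -/

/-- RH-FREE, PROVED: discharge of the named fact `CM22_lemma_4_2` (**Lemma 4.2** = arXiv Lemma 5.2:
(i) `u₁ + zu₂` has no zero on `(λ,∞)` for `z ∉ ℝ` and infinitely many for `z ∈ ℝ`; (ii) each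
`w_z = p^{1/4}∂(p^{1/4}u)/u`, `u = u₁ + zu₂`, `z ∉ ℝ`, solves the Riccati equation (4.2); (iii) every
solution of (4.2) is `w_z` for a unique `z ∉ ℝ`).  Printed proof followed: Abel's identity and the
Re/Im argument for (i) (oscillation of real solutions by Sturm comparison in Liouville normal form —
the tree's `Literature.Analysis.ODE.exists_zero_of_le_neg_sq`), the logarithmic-derivative
computation for (ii), and `u = exp∫(w − x/(2√p))/√p` + uniqueness for the linear equation (the
tree's `Literature.Analysis.ODE.eqOn_of_solution_Ioo`) for (iii).
[cite: ConnesMoscovici2022, Lemma 4.2 (= arXiv Lemma 5.2, chunk p0010:L41–L47; proof L49–L86)] -/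
theorem CM22_lemma_4_2_holds : CM22_lemma_4_2 := by
  intro lam hlam u₁ u₂ hu₁ hu₂ hL₁ hL₂ hW
  refine ⟨fun z hz x hx => add_mul_ne_zero_of_im_ne_zero hlam hu₁ hu₂ hL₁ hL₂ hW hz hx,
    fun z => infinite_zeros_add_mul hlam hu₁ hu₂ hL₁ hL₂ z,
    fun z hz => isRiccatiSol_wz hlam hu₁ hu₂ hL₁ hL₂
      (fun x hx => add_mul_ne_zero_of_im_ne_zero hlam hu₁ hu₂ hL₁ hL₂ hW hz hx),
    fun w hw => existsUnique_z_of_isRiccatiSol hlam hu₁ hu₂ hL₁ hL₂ hW hw⟩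

end Riccati

end Literature.NumberTheory.ConnesMoscovici2022
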